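import Summits.CriticalPhenomena.PercolationContinuityZ3.Theorems.Transplant.SkelFrmFromBChoiceAtQ3V
import Summits.CriticalPhenomena.PercolationContinuityZ3.Theorems.Transplant.SkelFrmFrom1ChoiceLTKPx
import Summits.CriticalPhenomena.PercolationContinuityZ3.Theorems.Transplant.SkelFrmFromBParamsKitS
import Summits.CriticalPhenomena.PercolationContinuityZ3.Theorems.Transplant.SkelFrmFrom1ParamsLBL
import Summits.CriticalPhenomena.PercolationContinuityZ3.Theorems.Transplant.SkelFrmFromBParamsBridge0
import HarnessLib

/-!
# GEN DEF-ROW (RULING D-Us, lead g21 V147b / Us-R1–R2 lead g22; WAVE-Us-MANIFEST v1.0 §3/§6/§9 (1)) «SkelFrmFromBChoiceDefsVPx» — the GENERALISED twin of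
# «SkelFrmFromBChoiceDefsV» §3–§4: **THE CHOICE DATA AND THE CHOICE FUNCTION OF RECORD UNDER PROXIES** — `NegB.choiceAtQ3VPx` (= `choiceAtQ3V` with the ONE slot change of
# §6 (a): least seed level `m₀ := max Neg.m₀ D`) and `frmChoiceAllQ3VPx D … : ChoiceFnNQPxAt D`; the bridges every GEN column row reads (`atQ3V_of_atQ3VPx`, `atQ3_of_atQ3VPx`)
# and the WIDTH FLOORS of the GEN input layer DISCHARGED ONCE from `AtQNQ` of the Px data (§10 C-4: `n > M ≥ M₀ ≥ k ≥ m₀ ≥ D`)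

builds on p205010 (kernel theorem, internal audit signed; external expert review pending) — nothing in this file uses p205010.  TWO definitions (`choiceAtQ3VPx`,
`frmChoiceAllQ3VPx`; review-queued by D-0009) + `rfl`/floor lemmas; no node / statement / `@[conjecture]`; NOTHING about the OPEN nodes U (`SamePDropOfSkeletonFrmFrom₁`) / U_s
(`SamePDropOfSkeletonFrmScaled₁`) is claimed.  Lane `prim-bschramm`, seat `prim-bschramm-gen-1` g0 (GEN pen); helper file (`--supports stmt-CriticalPhenomena-4575 --as helper`).
GEN hunk classes (WAVE-Us-MANIFEST §2): (i) the choice FUNCTION's binder `(h1) ↦ (hP : Φ.HasProxies t D)` (`ChoiceFnNQPxAt D`, «SkelFrmFrom1ChoiceDefsPx» §2); (iii) the seed floor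
`m₀ ↦ max m₀ D` — the ONLY field of the choice DATA that changes (`δI`, `Sz`, `SMn`, `Γ`, `FD`, `LD` are `choiceAtQ3V`'s by `rfl`), so `AtQNQ` of the Px data = `AtQNQ` of
`choiceAtQ3V` ∧ `D ≤ k` (`atQ3V_of_atQ3VPx`, `D_le_k_of_atQ3VPx`); from `D ≤ k` the input layer's width floors follow by the Params facts `k ≤ M₀ ≤ M_u < n_s`, `M_u ≤ M_L < n_L`,
`M_u + 3 ≤ n_Kit` («SkelFrmFrom1ParamsPO/LBL», «SkelFrmFromBParamsKitS»): `D_le_Mu/nS/nL/nKit_of_atQ3VPx` — hunk (iv)'s RADIUS terms `+ D` are NOT slots of the choice data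
(they live in the input lemmas' statements and in the column rows' numeric side conditions) and are discharged by the column tops at the tuple of record AT `D` (§11 (e);
the `+ D` slot CONSTRUCTORS, e.g. `60·(KS.Rs … + D + 1)` for `gxR0`, are filed with those tops).  ROW MAPPING (Us-R2): this file is the GEN twin of «…BChoiceDefsV»; the rows
«…BChoiceDefsPx» / «…Defs3Px» / «…DefsTPx» get NO twin — their only `h1` mentions are the `rfl` lemmas `frmChoiceAllQ_eq/…Q3_eq/…Q3T_eq/_scheme` of the SUPERSEDED choice
functions, which nothing below the U_s node reads (the Q3/Q3T choice DATA are reached `h1`-free through `atQ3_of_atQ3V` / the T bridges, as in U).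
[cite: KozmaNitzan2024, §4 Theorem 6 (pp. 25–31), pp. 19–21 ((21)–(25))] [cite: BenjaminiSchramm1996, Conj. 4] [this work]
-/

noncomputable section

open scoped Classical

namespace Summit.CriticalPhenomena.PercolationContinuityZ3.Theorems.Transplant

open MeasureTheory Literature.Probability.Percolation Literature.Probability.LatticeModels SimpleGraph KNCells
open Literature.Barriers.CriticalPhenomena (HasExponentialGrowth)

namespace PlanarSkeletonFrmFrom

open SkelConc (Consts)
open Skelφ (oriφ trφ)
open Skelφ.StepI (DataN DataNS OutNS)

namespace NegB

open Neg

/-! ## §1 The choice data of record under proxies: `choiceAtQ3VPx` (seed floor `max m₀ D`) -/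

section Values

variable (κ : Consts) {V : Type} [DecidableEq V] [Countable V] {G : SimpleGraph V} [G.LocallyFinite] (Φ : PlanarSkeletonFrmFrom G) (t : V)
  (p : unitInterval) (D : ℕ)

variable (Pv : PSlot) (gv fv : Neg.FSlot) (Sv : SSlot) (cv hv : CSlot) (bv : BSlot)

/-- **THE N2/U CHOICES OF RECORD UNDER PROXIES AT RADIUS `D`** at `(κ, Φ, t, p)`: `choiceAtQ3V` with the least seed level raised to `max Neg.m₀ D` (WAVE-Us-MANIFEST §6 (a):
the seed `Λ (prox c) k` must contain the centre `c`, which needs `k ≥ D` — `HasProxies.mem_fatSeq_prox`); every other field is `choiceAtQ3V`'s (`δI := δI3`, `Sz`, `SMn := SMnP`,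
`Γ := ΓQV`, `FD := FDQV`, `LD := LDQV`). [cite: KozmaNitzan2024, §4 Theorem 6 (pp. 25–31)] -/
def choiceAtQ3VPx (hC : Φ.CylSubcritical p) : ChoiceNQ κ Φ t p hC where
  δI := δI3 κ Φ
  m₀ := max Neg.m₀ D
  Sz := fun O => Neg.Sz O.merged
  SMn := fun O => SMnP κ Φ t p O.merged (gOf κ Φ t p O gv) (fOf κ Φ t p O fv) Pv
  Γ := fun O q => ΓQV κ Φ t p O gv fv Sv cv hv bv q
  FD := fun O q => FDQV κ Φ t p O gv fv Sv cv hv q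
  LD := fun O _ => LDQV κ Φ t p O gv fv cv hv
  δI_pos := δI3_pos κ Φ
  δI_lt_one := δI3_lt_one κ Φ
  S_adm := fun O _ => ⟨Neg.Sz_adm O.merged, SMnP_adm_at κ Φ t p O.merged _ _ Pv⟩

variable (hC : Φ.CylSubcritical p)

/-- The Step-I‴ accuracy of the Px choices is `δI3` (by `rfl`). [folklore] -/
@[simp] theorem choiceAtQ3VPx_δI : (choiceAtQ3VPx κ Φ t p D Pv gv fv Sv cv hv bv hC).δI = δI3 κ Φ := rfl

/-- **The least seed level of the Px choices is `max Neg.m₀ D`** (the one slot that changed). [this work] -/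
@[simp] theorem choiceAtQ3VPx_m₀ : (choiceAtQ3VPx κ Φ t p D Pv gv fv Sv cv hv bv hC).m₀ = max Neg.m₀ D := rfl

/-- The zone sizes are `choiceAtQ3V`'s (by `rfl`). [folklore] -/
@[simp] theorem choiceAtQ3VPx_Sz : (choiceAtQ3VPx κ Φ t p D Pv gv fv Sv cv hv bv hC).Sz = (choiceAtQ3V κ Φ t p Pv gv fv Sv cv hv bv hC).Sz := rfl

/-- The admissible pairs are `choiceAtQ3V`'s (by `rfl`). [folklore] -/
@[simp] theorem choiceAtQ3VPx_SMn : (choiceAtQ3VPx κ Φ t p D Pv gv fv Sv cv hv bv hC).SMn = (choiceAtQ3V κ Φ t p Pv gv fv Sv cv hv bv hC).SMn := rfl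

/-- The anchored cells are `ΓQV` (by `rfl`). [folklore] -/
@[simp] theorem choiceAtQ3VPx_Γ (O : OutNS V) (q : unitInterval) :
    (choiceAtQ3VPx κ Φ t p D Pv gv fv Sv cv hv bv hC).Γ O q = ΓQV κ Φ t p O gv fv Sv cv hv bv q := rfl

/-- The face data are `FDQV` (by `rfl`). [folklore] -/
@[simp] theorem choiceAtQ3VPx_FD (O : OutNS V) (q : unitInterval) :
    (choiceAtQ3VPx κ Φ t p D Pv gv fv Sv cv hv bv hC).FD O q = FDQV κ Φ t p O gv fv Sv cv hv q := rfl

/-- The level data are `LDQV` (by `rfl`). [folklore] -/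
@[simp] theorem choiceAtQ3VPx_LD (O : OutNS V) (q : unitInterval) :
    (choiceAtQ3VPx κ Φ t p D Pv gv fv Sv cv hv bv hC).LD O q = LDQV κ Φ t p O gv fv cv hv := rfl

/-- The scheme of the Px choices at `(O, q)` is `⟨ΓQV, q, κ.δ⟩` (by `rfl`) — the form the (R)/(F)/(C) GEN wrappers read. [folklore] -/
theorem choiceAtQ3VPx_scheme (O : OutNS V) (q : unitInterval) :
    (choiceAtQ3VPx κ Φ t p D Pv gv fv Sv cv hv bv hC).scheme O q = ⟨ΓQV κ Φ t p O gv fv Sv cv hv bv q, q, κ.δ⟩ := rfl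

/-- At radius `0` the Px choices ARE the choices of record (U is the `D = 0` instance). [folklore] -/
theorem choiceAtQ3VPx_zero : choiceAtQ3VPx κ Φ t p 0 Pv gv fv Sv cv hv bv hC = choiceAtQ3V κ Φ t p Pv gv fv Sv cv hv bv hC := rfl

end Values

/-! ## §2 `AtQNQ` of the Px data = `AtQNQ` of `choiceAtQ3V` and `D ≤ k`; the width floors of the GEN input layer -/

section AtQ

variable {κ : Consts} {V : Type} [DecidableEq V] [Countable V] {G : SimpleGraph V} [G.LocallyFinite] {Φ : PlanarSkeletonFrmFrom G} {t : V} {p : unitInterval}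
  {hC : Φ.CylSubcritical p} {D : ℕ} {gv fv : Neg.FSlot} {Pv : PSlot} {Sv : SSlot} {cv hv : CSlot} {bv : BSlot} {O : OutNS V} {q : unitInterval}

/-- **`AtQNQ` of the Px data gives `AtQNQ` of `choiceAtQ3V`** (the facts are antitone in the least seed level, `Neg.m₀ ≤ max Neg.m₀ D`; the other three fields it reads agree
by `rfl`) — so every `…_of_atQV` / `…_of_atQ3` lemma of the U wave and every landed GEN input lemma serves the Px function. [folklore] -/
theorem atQ3V_of_atQ3VPx (hAt : (choiceAtQ3VPx κ Φ t p D Pv gv fv Sv cv hv bv hC).AtQNQ O q) : (choiceAtQ3V κ Φ t p Pv gv fv Sv cv hv bv hC).AtQNQ O q :=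
  ⟨hAt.1.of_le (le_max_left _ _), hAt.2.1, hAt.2.2.1, hAt.2.2.2.1, hAt.2.2.2.2⟩

/-- … and of the landed S choices `choiceAtQ3` (through `atQ3_of_atQ3V`). [folklore] -/
theorem atQ3_of_atQ3VPx (hAt : (choiceAtQ3VPx κ Φ t p D Pv gv fv Sv cv hv bv hC).AtQNQ O q) : (choiceAtQ3 κ Φ t p Pv gv fv Sv cv bv hC).AtQNQ O q :=
  atQ3_of_atQ3V (atQ3V_of_atQ3VPx hAt)

/-- Conversely, `AtQNQ` of `choiceAtQ3V` together with `D ≤ k` gives `AtQNQ` of the Px data. [folklore] -/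
theorem atQ3VPx_of_atQ3V (hAt : (choiceAtQ3V κ Φ t p Pv gv fv Sv cv hv bv hC).AtQNQ O q) (hD : D ≤ O.D.k) :
    (choiceAtQ3VPx κ Φ t p D Pv gv fv Sv cv hv bv hC).AtQNQ O q :=
  ⟨⟨⟨max_le hAt.1.1.1 hD, hAt.1.1.2⟩, hAt.1.2⟩, hAt.2.1, hAt.2.2.1, hAt.2.2.2.1, hAt.2.2.2.2⟩

/-- **THE SEED FLOOR: `D ≤ k`** out of `AtQNQ` of the Px data (`max Neg.m₀ D ≤ k` is the first of the facts). [this work] -/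
theorem D_le_k_of_atQ3VPx (hAt : (choiceAtQ3VPx κ Φ t p D Pv gv fv Sv cv hv bv hC).AtQNQ O q) : D ≤ O.merged.k :=
  (le_max_right _ _).trans (Skelφ.StepI.OutO.FactsO.seed hAt.1.factsO).1

/-- `D ≤ M_u` (`k ≤ M₀ ≤ M_u`) — the floor of «SkelFrmFromBChoiceZonePx»'s `hcz_of_atQPx` / `hzconn_of_atQPx`. [folklore] -/
theorem D_le_Mu_of_atQ3VPx (hAt : (choiceAtQ3VPx κ Φ t p D Pv gv fv Sv cv hv bv hC).AtQNQ O q) : D ≤ Mu O.merged :=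
  (D_le_k_of_atQ3VPx hAt).trans (k_le_Mu O.merged (Skelφ.StepI.OutO.FactsO.seed hAt.1.factsO).2.2.1)

/-- `D ≤ n_s` (`M_u < n_s`) — the floor of the short-pair inputs «…AtQPx».`inputsSAt_of_atQPx`. [folklore] -/
theorem D_le_nS_of_atQ3VPx (hAt : (choiceAtQ3VPx κ Φ t p D Pv gv fv Sv cv hv bv hC).AtQNQ O q) : D ≤ nS O.merged :=
  (D_le_Mu_of_atQ3VPx hAt).trans (Mu_lt_nS O.merged).1.le

/-- `D ≤ n_L` at any box/width values `g`, `f` (`M_u ≤ M_L < n_L`) — the floor of the long-pair inputs «…AtQPx».`inputsLAt_of_atQPx` / «…LinksPx». [folklore] -/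
theorem D_le_nL_of_atQ3VPx (hAt : (choiceAtQ3VPx κ Φ t p D Pv gv fv Sv cv hv bv hC).AtQNQ O q) (g f : ℕ) : D ≤ nL κ Φ t p O.merged g f :=
  (D_le_Mu_of_atQ3VPx hAt).trans ((Mu_le_ML κ Φ t p O.merged g).trans (ML_lt_nL κ Φ t p O.merged g f).1.le)

/-- `D ≤ n_Kit` at any kit index `mk` (`M_u + 3 ≤ n_Kit`) — the floor of the kit inputs «…KitPx» / «…ZoneKPx». [folklore] -/
theorem D_le_nKit_of_atQ3VPx (hAt : (choiceAtQ3VPx κ Φ t p D Pv gv fv Sv cv hv bv hC).AtQNQ O q) (mk : ℕ) : D ≤ KS.nKit O.merged mk :=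
  (D_le_Mu_of_atQ3VPx hAt).trans (by have := (KS.nKit_facts O.merged mk).2.2.2; omega)

end AtQ

end NegB

/-! ## §3 The choice function of record under proxies at radius `D` -/

/-- **THE GEN CHOICE FUNCTION OF RECORD AT PROXY RADIUS `D`**, seven slots (box `gv`, width `fv`, extra pairs `Pv`, fibre block `Sv`, creep `cv`, forward room `hv`, arrival
box `bv`): the `ChoiceFnNQPxAt D` the four GEN column tops and the U_s node file meet (closure `drop_of_choiceFnNQLTKPx_at`) — at every skeleton with proxies it returns
`NegB.choiceAtQ3VPx … D …`; `frmChoiceAllQ3V` is the instance `D = 0` on one-type skeletons. [cite: KozmaNitzan2024, §4 Theorem 6 (pp. 25–31)] -/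
def frmChoiceAllQ3VPx (D : ℕ) (gv fv : Neg.FSlot) (Pv : NegB.PSlot) (Sv : NegB.SSlot) (cv hv : NegB.CSlot) (bv : NegB.BSlot) : ChoiceFnNQPxAt D :=
  fun κ _ _ _ _ _ Φ _ t _ _ p _ _ hC => NegB.choiceAtQ3VPx κ Φ t p D Pv gv fv Sv cv hv bv hC

/-- `frmChoiceAllQ3VPx` unfolds to `NegB.choiceAtQ3VPx` (by `rfl`). [folklore] -/
theorem frmChoiceAllQ3VPx_eq (D : ℕ) (gv fv : Neg.FSlot) (Pv : NegB.PSlot) (Sv : NegB.SSlot) (cv hv : NegB.CSlot) (bv : NegB.BSlot) (κ : Consts) {V : Type}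
    [DecidableEq V] [Countable V] (G : SimpleGraph V) [G.LocallyFinite] (Φ : PlanarSkeletonFrmFrom G) (hg : ¬ HasExponentialGrowth G) (t : V) (ht : t ∈ Φ.types)
    (hP : Φ.HasProxies t D) (p : unitInterval) (hp0 : 0 < (p : ℝ)) (hp1 : (p : ℝ) < 1) (hC : Φ.CylSubcritical p) :
    frmChoiceAllQ3VPx D gv fv Pv Sv cv hv bv κ G Φ hg t ht hP p hp0 hp1 hC = NegB.choiceAtQ3VPx κ Φ t p D Pv gv fv Sv cv hv bv hC := rfl

/-- The scheme of the GEN choice function of record at `(O, q)` is `⟨ΓQV, q, κ.δ⟩` (by `rfl`) — the form the (R)/(F)/(C) GEN wrappers read. [folklore] -/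
theorem frmChoiceAllQ3VPx_scheme (D : ℕ) (gv fv : Neg.FSlot) (Pv : NegB.PSlot) (Sv : NegB.SSlot) (cv hv : NegB.CSlot) (bv : NegB.BSlot) (κ : Consts) {V : Type}
    [DecidableEq V] [Countable V] (G : SimpleGraph V) [G.LocallyFinite] (Φ : PlanarSkeletonFrmFrom G) (hg : ¬ HasExponentialGrowth G) (t : V) (ht : t ∈ Φ.types)
    (hP : Φ.HasProxies t D) (p : unitInterval) (hp0 : 0 < (p : ℝ)) (hp1 : (p : ℝ) < 1) (hC : Φ.CylSubcritical p) (O : Skelφ.StepI.OutNS V) (q : unitInterval) :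
    (frmChoiceAllQ3VPx D gv fv Pv Sv cv hv bv κ G Φ hg t ht hP p hp0 hp1 hC).scheme O q = ⟨NegB.ΓQV κ Φ t p O gv fv Sv cv hv bv q, q, κ.δ⟩ := rfl

/-! ## §4 (appended) The root-bridge width floor -/

namespace NegB

open Neg

/-- `D ≤ n_B0` at any kit index `mk` (`M_u ≤ M_B0 < n_B0`, «SkelFrmFromBParamsBridge0») — the floor of the root-bridge inputs «…Bridge0Px». [folklore] -/
theorem D_le_nB0_of_atQ3VPx {κ : Consts} {V : Type} [DecidableEq V] [Countable V] {G : SimpleGraph V} [G.LocallyFinite] {Φ : PlanarSkeletonFrmFrom G} {t : V}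
    {p : unitInterval} {hC : Φ.CylSubcritical p} {D : ℕ} {gv fv : Neg.FSlot} {Pv : PSlot} {Sv : SSlot} {cv hv : CSlot} {bv : BSlot} {O : OutNS V} {q : unitInterval}
    (hAt : (choiceAtQ3VPx κ Φ t p D Pv gv fv Sv cv hv bv hC).AtQNQ O q) (mk : ℕ) : D ≤ KS.nB0 κ Φ t p O.merged mk :=
  (D_le_Mu_of_atQ3VPx hAt).trans ((KS.MB0_floors κ Φ t p O.merged mk).2.2.trans (KS.RF2_0 κ Φ t p O.merged mk).2.1.le)

end NegB

/-! ## §5 (appended) The face-bridge width floor ((F) column, p3 g27 #5680 / lead Us-R8 'on ask') -/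

namespace NegB

open Neg

/-- `D ≤ n_BF` at any face-bridge multiplier `c` and kit index `mk` (`M_u ≤ M_BF < n_BF`, «SkelFrmFromBParamsBridgeF») — the floor of the face-bridge inputs of the (F)
column under proxies. [folklore] -/
theorem D_le_nBF_of_atQ3VPx {κ : Consts} {V : Type} [DecidableEq V] [Countable V] {G : SimpleGraph V} [G.LocallyFinite] {Φ : PlanarSkeletonFrmFrom G} {t : V}
    {p : unitInterval} {hC : Φ.CylSubcritical p} {D : ℕ} {gv fv : Neg.FSlot} {Pv : PSlot} {Sv : SSlot} {cv hv : CSlot} {bv : BSlot} {O : OutNS V} {q : unitInterval}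
    (hAt : (choiceAtQ3VPx κ Φ t p D Pv gv fv Sv cv hv bv hC).AtQNQ O q) (c mk : ℕ) : D ≤ KS.nBF κ Φ t p O.merged c mk :=
  (D_le_Mu_of_atQ3VPx hAt).trans ((KS.MBF_floors κ Φ t p O.merged c mk).2.2.trans (KS.RF2F κ Φ t p O.merged c mk).2.1.le)

end NegB

end PlanarSkeletonFrmFrom

end Summit.CriticalPhenomena.PercolationContinuityZ3.Theorems.Transplant

end
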